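import Summits.ResolutionOfSingularities.ResolutionOfSingularities.Theorems.DecompositionDescentLU6
import HarnessLib

/-!
# DecompositionDescentLU (7/7) — layer 2, summit frame: the quasi-finite cell, `QuasiFinite → DecompositionField → RelLU`

Part 7 of the g27 node `DecompositionDescentLU` of the ROOT/RESIDUAL decomposition cell `decomp-res`
(lens 1, window (W-dec) of critic rows 178/193/202); see the module docstring of
`Summits.ResolutionOfSingularities.ResolutionOfSingularities.Theorems.DecompositionDescentLU` (part 1/7)
for the thesis, the three layers of [CossartPiltant2008, Prop. 9.3], the two currencies of the decomposition
cell (structure: `DecompositionFieldLUAbove`; witnesses: `DecWitnessLUAbove`), the laws, the residual R27, the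
cut and the sources.  Problem side, sorry-free, hypothesis-free.

This part: the cell `QuasiFiniteLUAbove k O`, `decompositionFieldLUAbove_of_quasiFiniteLUAbove`,
`relLU_of_quasiFiniteLUAbove`, `not_quasiFiniteLUAbove_of_not_decompositionFieldLUAbove` and the decided
cell piece `NonKHToricArchLUKeyHenselDescentQuotQFCell` (`_holds`).
-/

noncomputable section

open IsLocalRing IntermediateField Polynomial Literature.AlgebraicGeometry.Resolution
open scoped Pointwise

namespace Summit.ResolutionOfSingularities.ResolutionOfSingularities.Theorems.DecompositionDescentLU

universe u

/-! ## PART D (summit frame) — the QUASI-FINITE cell and its reduction to the decomposition-descent cell -/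

section Law2

variable {k K : Type} [Field k] [Field K] [Algebra k K]

variable (k)

/-- **THE CELL `QuasiFiniteLUAbove k O` — QUASI-FINITE UNIFORMIZATION UPSTAIRS, cut out by `K`-functions**
(a typed syntactic sub-class of places `(K, O)` over `k`, everything read in `K̄`; the EXACT INPUT of the
last paragraph of [CossartPiltant2008, proof of Prop. 9.3]).  There are: `O_E` above `O` with residues
algebraic over `k`; a Hensel root `η ∈ O_E` over `O` with `K`-rational residue; a layer `K ≤ K′ ≤ K(η)`;
such that every model `R ⊆ O` of `K | k` is contained in an affine model `k[t] ⊆ O_E` OF `K′` (`t ⊆ K′`,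
`Frac k[t] = K′`) which is REGULAR at the centre of `O_E` and whose closed point is RADICALLY CUT OUT BY
FINITELY MANY `K`-RATIONAL FUNCTIONS: a finite `F ⊆ K ∩ k[t]` of positive values with
`√(F·k[t]_𝔪) = 𝔪·k[t]_𝔪` — typed denominator-wise: every `y ∈ k[t]` of positive value has `b·yⁿ ∈ F·k[t]`
for some `b ∈ k[t]` of value `0` ([CossartPiltant2008, (52)] "`hᵢ` belongs to the ideal `(f₁, H)`").  It is
what [CossartPiltant2008, Prop. 8.1 + (46)–(51)] PRODUCE upstairs from a local uniformization of
`(K′, O_E ∩ K′)` by MONOMIALIZATION (embedded principalization upstairs — Hironaka-strength in dimension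
`≥ 4`, the honest residual crux of the henselization-descent problem, NEXT-g28.md); this node proves that
FROM this input on, everything is kernel: `QuasiFiniteLUAbove → DecompositionFieldLUAbove → RelLU`. (Sources:
CossartPiltant2008, proof of Prop. 9.3, (52) (HAL p. 28); Kuhlmann2000, §13.) -/
def QuasiFiniteLUAbove (O : ValuationSubring K) : Prop :=
  ∃ OE : ValuationSubring (AlgebraicClosure K), OE.comap (algebraMap K (AlgebraicClosure K)) = O ∧
  (∀ y ∈ OE, ∃ g : Polynomial k, g ≠ 0 ∧ OE.valuation (Polynomial.aeval y g) < 1) ∧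
  ∃ η : AlgebraicClosure K, η ∈ OE ∧
    (∃ x : K, OE.valuation (η - algebraMap K (AlgebraicClosure K) x) < 1) ∧
    (∃ f : Polynomial K, (∀ i, f.coeff i ∈ O) ∧ Polynomial.aeval η f = 0 ∧
      OE.valuation (Polynomial.aeval η (Polynomial.derivative f)) = 1) ∧
  ∃ K' : IntermediateField K (AlgebraicClosure K), K' ≤ K⟮η⟯ ∧
  ∀ R : Subalgebra k K, R.FG → IsFractionRing R K → R.toSubring ≤ O.toSubring →
    ∃ t : Finset (AlgebraicClosure K), (t : Set (AlgebraicClosure K)) ⊆ (K' : Set (AlgebraicClosure K)) ∧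
      R.map (IsScalarTower.toAlgHom k K (AlgebraicClosure K)) ≤
        Algebra.adjoin k (t : Set (AlgebraicClosure K)) ∧
      (Algebra.adjoin k (t : Set (AlgebraicClosure K))).toSubring ≤ OE.toSubring ∧
      K'.toSubfield ≤ Subfield.closure (Set.range (algebraMap k (AlgebraicClosure K)) ∪
        (t : Set (AlgebraicClosure K))) ∧
      IsRegularLocalRing (locAtCentre (Algebra.adjoin k (t : Set (AlgebraicClosure K))).toSubring OE) ∧
      ∃ F : Finset (AlgebraicClosure K),
        (F : Set (AlgebraicClosure K)) ⊆ Set.range (algebraMap K (AlgebraicClosure K)) ∧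
        (F : Set (AlgebraicClosure K)) ⊆ (Algebra.adjoin k (t : Set (AlgebraicClosure K)) :
          Set (AlgebraicClosure K)) ∧
        (∀ x ∈ F, OE.valuation x < 1) ∧
        ∀ y ∈ Algebra.adjoin k (t : Set (AlgebraicClosure K)), OE.valuation y < 1 →
          ∃ n : ℕ, ∃ b ∈ Algebra.adjoin k (t : Set (AlgebraicClosure K)), OE.valuation b = 1 ∧
            b * y ^ n ∈ Submodule.span (Algebra.adjoin k (t : Set (AlgebraicClosure K)))
              (F : Set (AlgebraicClosure K))

variable {k}

set_option maxHeartbeats 1600000 in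
/-- **LAYER 2 ⟹ LAYER 1 (kernel, hypothesis-free): `QuasiFiniteLUAbove k O → DecompositionFieldLUAbove k O`.**
For each model `R`, run the layer-2 engine on the generators of `R` (read in `K̄`): the normal model
`k[t₁] ⊇ R[F]` of `K` and its integral closure `k[t₁ ∪ t₁′]` in `K′` have `k[t₁ ∪ t₁′]_𝔪 = k[t]_𝔪 = S′`
by Zariski's Main Theorem, hence regular. (Sources: CossartPiltant2008, proof of Prop. 9.3, last paragraph (HAL p. 28).) -/
theorem decompositionFieldLUAbove_of_quasiFiniteLUAbove {O : ValuationSubring K}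
    (h : QuasiFiniteLUAbove k O) : DecompositionFieldLUAbove k O := by
  classical
  obtain ⟨OE, hOE, hres, η, hηO, hx, ⟨f, hfO, hfη, hder⟩, K', hK'η, hLU⟩ := h
  refine ⟨OE, hOE, η, hηO, hx, ⟨f, hfO, hfη, hder⟩, K', hK'η, fun R hRfg hRfrac hRO => ?_⟩
  haveI := hRfrac
  let L := AlgebraicClosure K
  let ι : K →+* L := algebraMap K L
  let φ : K →ₐ[k] L := IsScalarTower.toAlgHom k K L
  have hmemO : ∀ x : K, x ∈ O ↔ ι x ∈ OE := fun x => by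
    rw [← hOE]; rfl
  let M : Subfield L := ι.fieldRange
  have hMmem : ∀ y : L, y ∈ M ↔ ∃ x : K, ι x = y := fun y => RingHom.mem_fieldRange
  have hιM : ∀ x : K, ι x ∈ M := fun x => (hMmem _).mpr ⟨x, rfl⟩
  have hkM : ∀ c : k, algebraMap k L c ∈ M := fun c => by
    rw [IsScalarTower.algebraMap_apply k K L]; exact hιM _
  have hkO : ∀ c : k, algebraMap k L c ∈ OE := fun c => by
    rw [IsScalarTower.algebraMap_apply k K L, ← hmemO]; exact hRO (R.algebraMap_mem c)
  -- Hensel root data in `L`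
  have hfM : ∀ i, (f.map ι).coeff i ∈ M := fun i => by
    rw [Polynomial.coeff_map]; exact hιM _
  have hfη' : (f.map ι).eval η = 0 := by
    rw [Polynomial.eval_map, ← Polynomial.aeval_def]; exact hfη
  have hder' : OE.valuation ((derivative (f.map ι)).eval η) = 1 := by
    rw [Polynomial.derivative_map, Polynomial.eval_map, ← Polynomial.aeval_def]; exact hder
  -- `M ≤ K′ ≤ M(η)`
  have hMK' : M ≤ K'.toSubfield := fun y hy => by
    obtain ⟨x, rfl⟩ := (hMmem y).mp hy
    exact K'.algebraMap_mem x
  have hK'cl : K'.toSubfield ≤ Subfield.closure ((M : Set L) ∪ {η}) := by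
    intro y hy
    have hy' : y ∈ (K⟮η⟯).toSubfield := hK'η hy
    rw [IntermediateField.adjoin_toSubfield] at hy'
    have hMe : Set.range (algebraMap K L) = (M : Set L) := (RingHom.coe_fieldRange ι).symm
    rw [hMe] at hy'
    exact hy'
  -- the upstairs model dominating `R`
  obtain ⟨t, htK', hRt, htO, hK't, hreg, F, hFK, hFt, hFv, hrad⟩ := hLU R hRfg hRfrac hRO
  -- the generators of `R`, read in `L`
  obtain ⟨s₀, hs₀⟩ := hRfg
  let s : Finset L := s₀.image ι
  have hRmap : R.map φ = Algebra.adjoin k (s : Set L) := by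
    rw [← hs₀, AlgHom.map_adjoin, Finset.coe_image]; rfl
  have hsM : (s : Set L) ⊆ (M : Set L) := by
    intro z hz
    rw [Finset.mem_coe, Finset.mem_image] at hz
    obtain ⟨x, -, rfl⟩ := hz
    exact hιM x
  have hadj_cl : (Algebra.adjoin k (s : Set L) : Set L) ⊆
      (Subfield.closure (Set.range (algebraMap k L) ∪ (s : Set L)) : Set L) := by
    intro z hz
    rw [SetLike.mem_coe, ← Subalgebra.mem_toSubring, Algebra.adjoin_eq_ring_closure] at hz
    exact Subring.closure_le.mpr (fun w hw => Subfield.subset_closure hw) hz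
  have hMs : M ≤ Subfield.closure (Set.range (algebraMap k L) ∪ (s : Set L)) := by
    intro y hy
    obtain ⟨x, rfl⟩ := (hMmem y).mp hy
    obtain ⟨a, b, -, hab⟩ := IsFractionRing.div_surjective (A := R) x
    rw [← hab, map_div₀]
    have ha : ι a ∈ Algebra.adjoin k (s : Set L) := by
      rw [← hRmap]; exact Subalgebra.mem_map.mpr ⟨a, a.2, rfl⟩
    have hb : ι b ∈ Algebra.adjoin k (s : Set L) := by
      rw [← hRmap]; exact Subalgebra.mem_map.mpr ⟨b, b.2, rfl⟩
    exact div_mem (hadj_cl ha) (hadj_cl hb)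
  have hst : (s : Set L) ⊆ Algebra.adjoin k (t : Set L) := by
    intro z hz
    have : z ∈ R.map φ := by rw [hRmap]; exact Algebra.subset_adjoin hz
    exact hRt this
  have hFM : (F : Set L) ⊆ (M : Set L) := fun z hz => by
    obtain ⟨x, hx⟩ := hFK hz
    exact (hMmem z).mpr ⟨x, hx⟩
  -- the engine
  obtain ⟨t₁, ht₁M, hst₁, ht₁O, hnorm, t₁', ht₁'K', hext, hO', hreg'⟩ :=
    exists_normalization_regular_of_quasiFinite OE k hkM hkO hfM hfη' hder' K'.toSubfield hMK' hK'cl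
      hres s hsM hMs t htK' hst htO hK't hreg F hFM hFt hFv hrad
  refine ⟨t₁, fun z hz => (hMmem z).mp (ht₁M hz), ?_, ht₁O, fun x hint => hnorm (ι x) (hιM x) hint,
    t₁', ht₁'K', fun x hx => hext x hx, hO', hreg'⟩
  rw [hRmap]
  exact Algebra.adjoin_le hst₁

/-- **THE COMPOSITE LAW (kernel, hypothesis-free): `QuasiFiniteLUAbove k O → RelLocalUniformization k K O`**
— quasi-finite uniformization upstairs in a Hensel layer, radically cut out by `K`-functions, COMES DOWN. (Sources:
CossartPiltant2008, Prop. 9.3 (HAL pp. 26–28).) -/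
theorem relLU_of_quasiFiniteLUAbove {O : ValuationSubring K} (h : QuasiFiniteLUAbove k O) :
    RelLocalUniformization k K O :=
  relLU_of_decompositionFieldLUAbove (decompositionFieldLUAbove_of_quasiFiniteLUAbove h)

end Law2

/-! ## PART D (cut bookkeeping) — the quasi-finite cell piece is decided; `R27` is already off it -/

section Cut2

open Summit.ResolutionOfSingularities.ResolutionOfSingularities.Theses
open Summit.ResolutionOfSingularities.ResolutionOfSingularities.Theorems
open Summit.ResolutionOfSingularities.ResolutionOfSingularities.Theorems.KeyChainLU
open Summit.ResolutionOfSingularities.ResolutionOfSingularities.Theorems.HenselKeyChainLU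
open Summit.ResolutionOfSingularities.ResolutionOfSingularities.Theorems.GaloisDescentLU
open Summit.ResolutionOfSingularities.ResolutionOfSingularities.Theorems.PfaffLine
open Summit.ResolutionOfSingularities.ResolutionOfSingularities.Theorems.ToricLadder
open Summit.ResolutionOfSingularities.ResolutionOfSingularities.Theorems.KaplanskyLadder
open Summit.ResolutionOfSingularities.ResolutionOfSingularities.Theorems.PerronLadder
open Summit.ResolutionOfSingularities.ResolutionOfSingularities.Theorems.DefectlessLadder
open Summit.ResolutionOfSingularities.ResolutionOfSingularities.Theorems.WCut
open Summit.ResolutionOfSingularities.ResolutionOfSingularities.Theorems.TameQuotientLU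

variable {k K : Type} [Field k] [Field K] [Algebra k K]

/-- Off the decomposition-descent cell one is off the quasi-finite cell (contrapositive of layer 2): the new
residual `R27` carries `¬ QuasiFiniteLUAbove` for free — there is NO separate quasi-finite re-cut. [folklore] -/
theorem not_quasiFiniteLUAbove_of_not_decompositionFieldLUAbove {O : ValuationSubring K}
    (h : ¬ DecompositionFieldLUAbove k O) : ¬ QuasiFiniteLUAbove k O :=
  fun hq => h (decompositionFieldLUAbove_of_quasiFiniteLUAbove hq)

/-- **DECIDED PIECE, layer-2 form** (tag DECIDED — kernel theorem; WEAKER than the root): the g25 located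
residual restricted to the QUASI-FINITE cell — local uniformization UPSTAIRS in a finite Hensel layer whose
closed point is radically cut out by `K`-functions ([CossartPiltant2008, (52)]) comes down, for all
parameters. -/
def NonKHToricArchLUKeyHenselDescentQuotQFCell (e c n : ℕ) : Prop :=
  ∀ p : ℕ, p.Prime → ∀ (k K : Type) [Field k] [CharP k p] [Field K] [Algebra k K],
    Algebra.trdeg k K ≤ n → ∀ O : ValuationSubring K, Nonempty O.valuation.RankOne →
    (∀ y ∈ O, ∃ f : Polynomial k, f ≠ 0 ∧ Polynomial.aeval y f ∈ O.nonunits) →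
    ¬ IsAbhyankarPlace O (algebraMap k K).fieldRange ⊤ →
    ¬ (∃ d : ℕ, d < n ∧ SepDenseBelow k O d) → ¬ ToricDenseBelow k O e → ¬ KHTopBelow k O c →
    ¬ KeyChainTopBelow k O → ¬ HenselKeyChainTopBelow k O → ¬ GaloisHenselDescentDatum k O →
    ¬ TameQuotientLU.TameEquivariantLUAbove k O →
    QuasiFiniteLUAbove k O → RelLocalUniformization k K O

/-- The composite law decides the quasi-finite cell piece outright. [folklore] -/
theorem nonKHToricArchLUKeyHenselDescentQuotQFCell_holds (e c n : ℕ) :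
    NonKHToricArchLUKeyHenselDescentQuotQFCell e c n :=
  fun _ _ _ _ _ _ _ _ _ _ _ _ _ _ _ _ _ _ _ _ hQ => relLU_of_quasiFiniteLUAbove hQ

end Cut2

end Summit.ResolutionOfSingularities.ResolutionOfSingularities.Theorems.DecompositionDescentLU

end
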